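import Literature.Probability.LatticeModels.IsingPlusEdwardsSokal
import HarnessLib

/-!
# Edwards–Sokal with plus boundary conditions, `n`-point counting

Topic `Literature/Probability/LatticeModels`. The file `IsingPlusEdwardsSokal` proves the plus /
wired Edwards–Sokal identity for ONE spin, `⟨σ_0⟩⁺_{Λ_n} = φ¹(0 ↔ ∂Λ_{n+1})` (G. Grimmett, *The
Random-Cluster Model* (2006), Thm. 1.16 with the wired boundary condition of §4.2, (4.12)–(4.13);
Edwards–Sokal 1988), from the count `∑_σ 1{σ = 1 on W} 1_F(σ,ω) σ_0 ∈ {2^{k^W(ω)-1}, 0}`. This file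
runs the same count with `n` marked points `a₀, …, a_{n-1}` of a finite graph (repetitions
allowed), for the spin monomial `∏ⱼ σ_{aⱼ}`:

* `sum_boole_plus_bondSpin_mul_spinMonomial_of_even` / `…_of_not_even` (finite vertex type, wired
  set `W ≠ ∅`): summing `∏ⱼ σ_{aⱼ}` over the `±1`-configurations equal to `+1` on `W` and constant
  on the open clusters of `ω` gives `2^{k^W(ω) - 1}` if every open cluster NOT joined to `W` holds
  an even number of the indices `j` (counted with multiplicity), and `0` otherwise: in the even case
  the monomial is identically `1` on such configurations (`spinMonomial_eq_one_of_plus_bondSpin`: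
  group the indices by open cluster; a cluster coloured `-1` is not joined to `W`), in the odd case
  flipping an odd cluster off `W` is a sign-reversing involution (`exists_flip_of_odd`).

The finite-volume identity on boxes of `ℤ^d` built on this count is the file
`IsingPlusEdwardsSokalNPointBox`. Events are phrased with the open graph `openGraph ω` only (no
wired graph) and with `Set.ncard`, so that no decidability instance enters the statements.

## References

* G. Grimmett, *The Random-Cluster Model*, Springer 2006: §1.4 Thm. 1.16 (and its proof),
  §4.2 (4.12) — bib key `Grimmett2006`.
* R. G. Edwards, A. D. Sokal, Phys. Rev. D 38 (1988) 2009–2012 — bib key `EdwardsSokal1988`.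
-/

noncomputable section

namespace Literature.Probability.LatticeModels

open MeasureTheory Finset SimpleGraph
open Literature.Barriers.CriticalPhenomena

section Counting

variable {V : Type*} [Fintype V] [DecidableEq V]

omit [DecidableEq V] in
/-- The size of a subset of a finite index type cut out by a predicate, as a `Finset.card`. [folklore] -/
theorem ncard_setOf_eq_card_filter {ι : Type*} [Fintype ι] (p : ι → Prop) [DecidablePred p] :
    {i | p i}.ncard = #(univ.filter p) := by
  rw [← Set.ncard_coe_finset, Finset.coe_filter_univ]

omit [Fintype V] [DecidableEq V] in
/-- **Even case, pointwise**: if `σ = +1` on `W`, `σ` is constant on the open clusters of `ω`, and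
every open cluster not joined to `W` holds an even number of the marked indices, then
`∏ⱼ σ_{aⱼ} = 1` (group the indices by open cluster: a cluster coloured `-1` is not joined to `W`,
hence holds an even number of indices). [cite: Grimmett2006, §1.4 Thm. 1.16 (proof) and §4.2] -/
theorem spinMonomial_eq_one_of_plus_bondSpin (ω : Finset (Sym2 V)) {W : Set V} {σ : SpinConfig V}
    (hW : ∀ w ∈ W, σ w = 1) (hω : ∀ e ∈ ω, bondSpin σ e = 1) {n : ℕ} {a : Fin n → V}
    (hE : ∀ j, (¬ ∃ w ∈ W, (Percolation.openGraph (↑ω : Percolation.BondConfig V)).Reachable (a j) w) →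
      Even {i | (Percolation.openGraph (↑ω : Percolation.BondConfig V)).Reachable (a j) (a i)}.ncard) :
    spinMonomial a σ = 1 := by
  classical
  set H : SimpleGraph V := Percolation.openGraph (↑ω : Percolation.BondConfig V) with hH
  have hconst : ∀ {u v : V}, H.Reachable u v → σ u = σ v := fun huv =>
    apply_eq_of_reachable ((forall_bondSpin_eq_one_iff ω σ).1 hω) huv
  -- the class of an index
  set cls : Fin n → Finset (Fin n) := fun j => univ.filter fun i => H.Reachable (a j) (a i) with hcls
  have hcls_eq : ∀ {i j : Fin n}, H.Reachable (a j) (a i) → cls i = cls j := by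
    intro i j hji
    ext k
    simp only [hcls, Finset.mem_filter, Finset.mem_univ, true_and]
    exact ⟨fun h => hji.trans h, fun h => hji.symm.trans h⟩
  have hfiber : ∀ j, (univ.filter fun i => cls i = cls j) = cls j := by
    intro j
    ext i
    simp only [Finset.mem_filter, Finset.mem_univ, true_and]
    constructor
    · intro h
      have hi : i ∈ cls i := by simp [hcls]
      rw [h] at hi
      simpa [hcls] using hi
    · intro hi
      have hji : H.Reachable (a j) (a i) := by simpa [hcls] using hi
      exact hcls_eq hji
  unfold spinMonomial
  rw [← Finset.prod_fiberwise_of_maps_to (s := univ) (t := univ.image cls) (g := cls)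
    (fun i _ => Finset.mem_image_of_mem cls (Finset.mem_univ i))]
  refine Finset.prod_eq_one fun c hc => ?_
  obtain ⟨j, -, rfl⟩ := Finset.mem_image.1 hc
  rw [hfiber j]
  have hprod : ∏ i ∈ cls j, spinAt (a i) σ = ∏ _i ∈ cls j, spinAt (a j) σ := by
    refine Finset.prod_congr rfl fun i hi => ?_
    have hji : H.Reachable (a j) (a i) := by simpa [hcls] using hi
    simp only [spinAt, hconst hji]
  rw [hprod, Finset.prod_const]
  rcases spinAt_eq_one_or_eq_neg_one (a j) σ with h1 | h1
  · rw [h1, one_pow]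
  · have hjW : ¬ ∃ w ∈ W, H.Reachable (a j) w := by
      rintro ⟨w, hw, hjw⟩
      have : spinAt (a j) σ = 1 := by simp [spinAt, hconst hjw, hW w hw]
      rw [this] at h1
      norm_num at h1
    have hev : Even #(cls j) := by
      have h := hE j hjW
      rwa [ncard_setOf_eq_card_filter] at h
    rw [h1, hev.neg_one_pow]

omit [Fintype V] [DecidableEq V] in
/-- **Odd case, the cluster flip** (Grimmett 2006, proof of Thm. 1.16, with `n` marked points): if
the open cluster of `aⱼ` is not joined to the wired set and holds an odd number of the marked
indices, flipping it is an involution of the configurations which fixes `W` pointwise, preserves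
"constant along the open edges", and reverses the sign of `∏ᵢ σ_{aᵢ}`. [cite: Grimmett2006, §1.4 Thm. 1.16 (proof) and §4.2] -/
theorem exists_flip_of_odd (ω : Finset (Sym2 V)) (W : Set V) {n : ℕ} (a : Fin n → V) {j : Fin n}
    (hjW : ¬ ∃ w ∈ W, (Percolation.openGraph (↑ω : Percolation.BondConfig V)).Reachable (a j) w)
    (hodd : Odd {i | (Percolation.openGraph (↑ω : Percolation.BondConfig V)).Reachable (a j) (a i)}.ncard) :
    ∃ φ : SpinConfig V → SpinConfig V, Function.Involutive φ ∧
      (∀ σ, ((∀ w ∈ W, φ σ w = 1) ∧ ∀ e ∈ ω, bondSpin (φ σ) e = 1) ↔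
        ((∀ w ∈ W, σ w = 1) ∧ ∀ e ∈ ω, bondSpin σ e = 1)) ∧
      ∀ σ, spinMonomial a (φ σ) = -spinMonomial a σ := by
  classical
  set H : SimpleGraph V := Percolation.openGraph (↑ω : Percolation.BondConfig V) with hH
  set o := a j with ho
  set φ : SpinConfig V → SpinConfig V := fun σ v => if H.Reachable o v then -σ v else σ v with hφ
  have hφi : Function.Involutive φ := by
    intro σ
    funext v
    by_cases hv : H.Reachable o v <;> simp [φ, hv]
  have key : ∀ {a b : V}, H.Adj a b → (H.Reachable o a ↔ H.Reachable o b) := fun hab =>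
    ⟨fun h => h.trans hab.reachable, fun h => h.trans hab.symm.reachable⟩
  have hWfix : ∀ σ : SpinConfig V, ∀ w ∈ W, φ σ w = σ w := by
    intro σ w hw
    have : ¬ H.Reachable o w := fun h => hjW ⟨w, hw, h⟩
    simp only [hφ, this, if_false]
  have hF : ∀ σ : SpinConfig V, (∀ e ∈ ω, bondSpin (φ σ) e = 1) ↔ ∀ e ∈ ω, bondSpin σ e = 1 := by
    intro σ
    rw [forall_bondSpin_eq_one_iff, forall_bondSpin_eq_one_iff]
    constructor
    · intro h a b hab
      have hab' := h hab
      by_cases ha : H.Reachable o a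
      · have hb : H.Reachable o b := (key hab).1 ha
        simp only [φ, if_pos ha, if_pos hb, neg_inj] at hab'
        exact hab'
      · have hb : ¬ H.Reachable o b := fun hb => ha ((key hab).2 hb)
        simp only [φ, if_neg ha, if_neg hb] at hab'
        exact hab'
    · intro h a b hab
      by_cases ha : H.Reachable o a
      · have hb : H.Reachable o b := (key hab).1 ha
        simp only [φ, if_pos ha, if_pos hb, h hab]
      · have hb : ¬ H.Reachable o b := fun hb => ha ((key hab).2 hb)
        simp only [φ, if_neg ha, if_neg hb, h hab]
  refine ⟨φ, hφi, fun σ => ?_, fun σ => ?_⟩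
  · rw [hF σ]
    refine and_congr_left fun _ => ?_
    exact forall₂_congr fun w hw => by rw [hWfix σ w hw]
  · have hsp : ∀ i, spinAt (a i) (φ σ) =
        (if H.Reachable o (a i) then (-1 : ℝ) else 1) * spinAt (a i) σ := by
      intro i
      by_cases hi : H.Reachable o (a i)
      · simp only [spinAt, φ, if_pos hi, Units.val_neg, Int.cast_neg, neg_mul, one_mul]
      · simp only [spinAt, φ, if_neg hi, one_mul]
    have hodd' : Odd #(univ.filter fun i => H.Reachable o (a i)) := by
      rwa [ncard_setOf_eq_card_filter] at hodd
    unfold spinMonomial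
    simp_rw [hsp]
    rw [Finset.prod_mul_distrib, Finset.prod_ite, Finset.prod_const, Finset.prod_const_one, mul_one,
      hodd'.neg_one_pow, neg_one_mul]

/-- **`n`-point plus/wired Edwards–Sokal counting, even case** (Grimmett 2006, Thm. 1.16 / (4.12)
run with `n` marked points `a₀, …, a_{n-1}`, `q = 2`, Ising spins `±1`): if every open cluster of
`ω` not joined to the nonempty wired set `W` holds an even number of the indices, then
`∑_σ 1{σ = 1 on W} 1_F(σ,ω) ∏ⱼ σ_{aⱼ} = 2^{k^W(ω) - 1}`. [cite: Grimmett2006, §1.4 Thm. 1.16 and §4.2 eq. (4.12)] -/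
theorem sum_boole_plus_bondSpin_mul_spinMonomial_of_even (ω : Finset (Sym2 V)) {W : Set V}
    [DecidablePred (· ∈ W)] (hWne : W.Nonempty) {n : ℕ} (a : Fin n → V)
    (hE : ∀ j, (¬ ∃ w ∈ W, (Percolation.openGraph (↑ω : Percolation.BondConfig V)).Reachable (a j) w) →
      Even {i | (Percolation.openGraph (↑ω : Percolation.BondConfig V)).Reachable (a j) (a i)}.ncard) :
    ∑ σ : SpinConfig V, (if (∀ w ∈ W, σ w = 1) ∧ ∀ e ∈ ω, bondSpin σ e = 1 then (1 : ℝ) else 0) *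
        spinMonomial a σ = (2 : ℝ) ^ (clusterCount (↑ω : Percolation.BondConfig V) W - 1) := by
  rw [← sum_boole_plus_bondSpin_eq ω hWne]
  refine Finset.sum_congr rfl fun σ _ => ?_
  split_ifs with h
  · rw [one_mul, spinMonomial_eq_one_of_plus_bondSpin ω h.1 h.2 hE]
  · rw [zero_mul]

/-- **`n`-point plus/wired Edwards–Sokal counting, odd case** (Grimmett 2006, Thm. 1.16 / (4.12)
run with `n` marked points): if some open cluster of `ω` not joined to the wired set `W` holds an
odd number of the indices, then `∑_σ 1{σ = 1 on W} 1_F(σ,ω) ∏ⱼ σ_{aⱼ} = 0` (flip that cluster).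
[cite: Grimmett2006, §1.4 Thm. 1.16 and §4.2 eq. (4.12)] -/
theorem sum_boole_plus_bondSpin_mul_spinMonomial_of_not_even (ω : Finset (Sym2 V)) {W : Set V}
    [DecidablePred (· ∈ W)] {n : ℕ} (a : Fin n → V)
    (hE : ¬ ∀ j, (¬ ∃ w ∈ W, (Percolation.openGraph (↑ω : Percolation.BondConfig V)).Reachable (a j) w) →
      Even {i | (Percolation.openGraph (↑ω : Percolation.BondConfig V)).Reachable (a j) (a i)}.ncard) :
    ∑ σ : SpinConfig V, (if (∀ w ∈ W, σ w = 1) ∧ ∀ e ∈ ω, bondSpin σ e = 1 then (1 : ℝ) else 0) *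
        spinMonomial a σ = 0 := by
  classical
  obtain ⟨j, hj⟩ := not_forall.1 hE
  obtain ⟨hjW, hodd⟩ := Classical.not_imp.1 hj
  rw [Nat.not_even_iff_odd] at hodd
  obtain ⟨φ, hφi, hF, hf⟩ := exists_flip_of_odd ω W a hjW hodd
  -- the flip is a sign-reversing involution of the summand
  have hS := (Fintype.sum_equiv (Function.Involutive.toPerm φ hφi)
    (fun σ => (if (∀ w ∈ W, φ σ w = 1) ∧ ∀ e ∈ ω, bondSpin (φ σ) e = 1 then (1 : ℝ) else 0) *
      spinMonomial a (φ σ))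
    (fun σ => (if (∀ w ∈ W, σ w = 1) ∧ ∀ e ∈ ω, bondSpin σ e = 1 then (1 : ℝ) else 0) *
      spinMonomial a σ) fun σ => rfl)
  simp_rw [hF, hf, mul_neg, Finset.sum_neg_distrib] at hS
  linarith

end Counting

end Literature.Probability.LatticeModels

end
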